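import Summits.KontsevichZagierPeriods.KontsevichZagierPeriods.Theorems.MzvKernelInKZ.Negative.Duality

/-!
# `MzvKernelInKZ` (stmt-KontsevichZagierPeriods-3914): negative side — per-weight rungs and the finite-rank engine

Companion of `Negative/Core.lean`.  The per-weight rungs `WeightKernel w ⊇ WeightKernelAdm w` of
the crux (the idea cards' `WeightKernel N`) and the FINITE-RANK ENGINE `weightKernelAdm_of_basis` /
`weightKernelAdm_of_rankOne`: if the values of a base family of admissible words of weight `w` are
`ℚ`-linearly independent and every admissible word representation is congruent modulo relations
to a rational combination of the base (spanning INSIDE the calculus), the weight-`w` rung holds;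
conversely the rung forces the spanning half (`sub_nf_mem_relations_of_weightKernelAdm`).  This
shows exactly where transcendence enters: vacuously in no weight, as `value ≠ 0` when `d_w = 1`
(`w = 2, 3, 4`), as an open independence statement from `w = 5` on.

Sources: M. Kontsevich, D. Zagier, *Periods* (2001), §1.2; D. Zagier (1994), §9. -/

noncomputable section

namespace Summit.KontsevichZagierPeriods.MzvKernelInKZ.Negative

open Set MeasureTheory MvPolynomial
open Literature.NumberTheory.Transcendental
open Summit.KontsevichZagierPeriods.KontsevichZagierPeriods.Theses.LinRedNormalForm (MzvKernelInKZ)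

section Engine

variable {w k : ℕ}

/-- Generators of a fixed weight `w` (all letters). [folklore] -/
def genSetW (w : ℕ) : Set KZ.FormalRep :=
  {x | ∃ (ε : Fin w → Bool) (q : ℚ) (s : KZ.IntegralRep w),
    s.domain = simplex w ∧ EqOn s.integrand (wordFun ε q) s.domain ∧ x = KZ.of s}

/-- Generators of weight `w` with ADMISSIBLE letters (the others are zero representations). [folklore] -/
def genSetAdm (w : ℕ) : Set KZ.FormalRep :=
  {x | ∃ (ε : Fin w → Bool) (q : ℚ) (s : KZ.IntegralRep w),
    Adm ε ∧ s.domain = simplex w ∧ EqOn s.integrand (wordFun ε q) s.domain ∧ x = KZ.of s}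

/-- The weight-`w` rung of the crux (the cards' `WeightKernel w`). -/
def WeightKernel (w : ℕ) : Prop :=
  ∀ c ∈ AddSubgroup.closure (genSetW w), KZ.eval c = 0 → c ∈ KZ.relations

/-- The weight-`w` rung over admissible letters. -/
def WeightKernelAdm (w : ℕ) : Prop :=
  ∀ c ∈ AddSubgroup.closure (genSetAdm w), KZ.eval c = 0 → c ∈ KZ.relations

/-- Weight-`w` generators are generators. [folklore] -/
theorem genSetW_subset_genSet : genSetW w ⊆ genSet := by
  rintro x ⟨ε, q, s, hd, hi, rfl⟩
  exact ⟨w, ε, q, s, hd, hi, rfl⟩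

/-- Admissible weight-`w` generators are weight-`w` generators. [folklore] -/
theorem genSetAdm_subset_genSetW : genSetAdm w ⊆ genSetW w := by
  rintro x ⟨ε, q, s, -, hd, hi, rfl⟩
  exact ⟨ε, q, s, hd, hi, rfl⟩

/-- The rungs are honest special cases of the crux. [folklore] -/
theorem weightKernel_of_crux (h : MzvKernelInKZ) : WeightKernel w :=
  fun c hc => h c (AddSubgroup.closure_mono genSetW_subset_genSet hc)

/-- The admissible rung is a special case of the full weight-`w` rung. [folklore] -/
theorem weightKernelAdm_of_weightKernel (h : WeightKernel w) : WeightKernelAdm w :=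
  fun c hc => h c (AddSubgroup.closure_mono genSetAdm_subset_genSetW hc)

/-- The admissible weight-`w` rung is a special case of the crux. [folklore] -/
theorem weightKernelAdm_of_crux (h : MzvKernelInKZ) : WeightKernelAdm w :=
  weightKernelAdm_of_weightKernel (weightKernel_of_crux h)

/-- Canonical word representations with admissible letters are admissible generators. [folklore] -/
theorem of_wordRep_mem_genSetAdm (ε : Fin w → Bool) (q : ℚ) (hε : Adm ε) :
    KZ.of (wordRep ε q hε) ∈ genSetAdm w :=
  ⟨ε, q, wordRep ε q hε, hε, rfl, fun _ _ => rfl, rfl⟩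

variable (B : Fin k → (Fin w → Bool)) (hB : ∀ j, Adm (B j))

/-- NORMAL FORM with respect to a base family `B` of admissible words: `∑ⱼ [Δ_w, Qⱼ · ω_{Bⱼ}]`. [folklore] -/
def nf (Q : Fin k → ℚ) : KZ.FormalRep := ∑ j, KZ.of (wordRep (B j) (Q j) (hB j))

/-- Normal forms lie in the admissible closure. [folklore] -/
theorem nf_mem_closure (Q : Fin k → ℚ) : nf B hB Q ∈ AddSubgroup.closure (genSetAdm w) :=
  sum_mem fun _ _ => AddSubgroup.subset_closure (of_wordRep_mem_genSetAdm _ _ _)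

/-- The normal form with zero coefficients is a relation (zero integrands). [folklore] -/
theorem nf_zero_mem_relations : nf B hB 0 ∈ KZ.relations :=
  sum_mem fun _ _ => of_wordRep_zero_mem_relations _ _

/-- Additivity of normal forms in the coefficients, modulo relations (integrand additivity). [folklore] -/
theorem nf_add (Q₁ Q₂ : Fin k → ℚ) :
    nf B hB (Q₁ + Q₂) - nf B hB Q₁ - nf B hB Q₂ ∈ KZ.relations := by
  simp only [nf, ← Finset.sum_sub_distrib, Pi.add_apply]
  exact sum_mem fun j _ => of_wordRep_add _ _ _ _

/-- `nf Q + nf (−Q)` is a relation. [folklore] -/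
theorem nf_neg (Q : Fin k → ℚ) : nf B hB Q + nf B hB (-Q) ∈ KZ.relations := by
  simp only [nf, ← Finset.sum_add_distrib, Pi.neg_apply]
  exact sum_mem fun j _ => of_wordRep_neg _ _ _

/-- Rational rescaling of a normal form is the normal form of the rescaled coefficients, modulo
relations (`KZ.scale` multiplies integrands; no formal division is used). [folklore] -/
theorem scale_nf_sub_nf (q : ℚ) (Q : Fin k → ℚ) :
    KZ.scale (q : ℝ) (isAlgebraic_ratCast q) (nf B hB Q) - nf B hB (q • Q) ∈ KZ.relations := by
  simp only [nf, map_sum, KZ.scale_of, ← Finset.sum_sub_distrib, Pi.smul_apply, smul_eq_mul]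
  refine sum_mem fun j _ => of_sub_of_mem_relations_of_eqOn rfl fun t _ => ?_
  simp only [KZ.IntegralRep.integrand_constMul, wordRep_integrand, wordFun, Rat.cast_mul]
  ring

/-- The value of a normal form: `∑ⱼ Qⱼ · value [Δ, ω_{Bⱼ}]`. [folklore] -/
theorem eval_nf (Q : Fin k → ℚ) :
    KZ.eval (nf B hB Q) = ∑ j, (Q j : ℝ) * (wordRep (B j) 1 (hB j)).value := by
  simp only [nf, map_sum, KZ.eval_of]
  exact Finset.sum_congr rfl fun j _ => value_wordRep _ _ _

/-- **THE FINITE-RANK ENGINE.** If the values of a base family `B` of admissible words of weight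
`w` are `ℚ`-linearly independent, and every admissible word representation of weight `w` is
congruent MODULO RELATIONS to a rational combination of the base representations (spanning INSIDE
the calculus), then the weight-`w` rung of the crux holds.  Proof: every element of the closure is
congruent to a normal form `∑ⱼ [Δ, Qⱼ ω_{Bⱼ}]` (integrand additivity, `KZ.scale`); `eval c = 0`
and independence force `Q = 0`; zero representations are relations.  This is the honest content of
the cards' transfer "HoffmanIndependence N → certificates N → WeightKernel N". [folklore] -/
theorem weightKernelAdm_of_basis
    (hind : LinearIndependent ℚ (fun j => (wordRep (B j) 1 (hB j)).value))
    (hspan : ∀ (ε : Fin w → Bool) (hε : Adm ε), ∃ a : Fin k → ℚ,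
      KZ.of (wordRep ε 1 hε) - nf B hB a ∈ KZ.relations) :
    WeightKernelAdm w := by
  intro c hc hc0
  have key : ∃ Q : Fin k → ℚ, c - nf B hB Q ∈ KZ.relations := by
    clear hc0
    induction hc using AddSubgroup.closure_induction with
    | mem x hx =>
      obtain ⟨ε, q, s, hε, hd, hi, rfl⟩ := hx
      obtain ⟨a, ha⟩ := hspan ε hε
      refine ⟨q • a, ?_⟩
      have h1 : KZ.of s - KZ.of (wordRep ε q hε) ∈ KZ.relations :=
        of_sub_of_wordRep_mem_relations hε s hd hi
      have h2 := KZ.scale_mem_relations (q : ℝ) (isAlgebraic_ratCast q) ha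
      rw [map_sub, KZ.scale_of] at h2
      have h3 : KZ.of ((wordRep ε 1 hε).constMul (q : ℝ) (isAlgebraic_ratCast q)) -
          KZ.of (wordRep ε q hε) ∈ KZ.relations :=
        of_sub_of_mem_relations_of_eqOn rfl fun t _ => by
          simp only [KZ.IntegralRep.integrand_constMul, wordRep_integrand, wordFun, Rat.cast_one]
          ring
      have h4 := scale_nf_sub_nf B hB q a
      have : KZ.of s - nf B hB (q • a) =
          (KZ.of s - KZ.of (wordRep ε q hε)) -
          (KZ.of ((wordRep ε 1 hε).constMul (q : ℝ) (isAlgebraic_ratCast q)) -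
            KZ.of (wordRep ε q hε)) +
          (KZ.of ((wordRep ε 1 hε).constMul (q : ℝ) (isAlgebraic_ratCast q)) -
            KZ.scale (q : ℝ) (isAlgebraic_ratCast q) (nf B hB a)) +
          (KZ.scale (q : ℝ) (isAlgebraic_ratCast q) (nf B hB a) - nf B hB (q • a)) := by abel
      rw [this]
      exact KZ.relations.add_mem (KZ.relations.add_mem (KZ.relations.sub_mem h1 h3) h2) h4
    | zero =>
      refine ⟨0, ?_⟩
      simpa using KZ.relations.neg_mem (nf_zero_mem_relations B hB)
    | add x y _ _ ihx ihy =>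
      obtain ⟨Q₁, h₁⟩ := ihx
      obtain ⟨Q₂, h₂⟩ := ihy
      refine ⟨Q₁ + Q₂, ?_⟩
      have : x + y - nf B hB (Q₁ + Q₂) =
          (x - nf B hB Q₁) + (y - nf B hB Q₂) - (nf B hB (Q₁ + Q₂) - nf B hB Q₁ - nf B hB Q₂) := by
        abel
      rw [this]
      exact KZ.relations.sub_mem (KZ.relations.add_mem h₁ h₂) (nf_add B hB Q₁ Q₂)
    | neg x _ ih =>
      obtain ⟨Q, hQ⟩ := ih
      refine ⟨-Q, ?_⟩
      have : -x - nf B hB (-Q) = -(x - nf B hB Q) - (nf B hB Q + nf B hB (-Q)) := by abel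
      rw [this]
      exact KZ.relations.sub_mem (KZ.relations.neg_mem hQ) (nf_neg B hB Q)
  obtain ⟨Q, hQ⟩ := key
  have hev : KZ.eval (nf B hB Q) = 0 := by
    have h := (AddMonoidHom.mem_ker).1 (KZ.relations_le_ker_eval_holds hQ)
    rwa [map_sub, hc0, zero_sub, neg_eq_zero] at h
  rw [eval_nf] at hev
  have hQ0 : ∀ j, Q j = 0 := by
    refine Fintype.linearIndependent_iff.mp hind Q ?_
    simpa [Rat.smul_def] using hev
  have hQz : Q = 0 := funext hQ0
  subst hQz
  have : c = (c - nf B hB 0) + nf B hB 0 := by abel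
  rw [this]
  exact KZ.relations.add_mem hQ (nf_zero_mem_relations B hB)

/-- Cheap converse (the SPANNING half is forced by the rung, given the real-valued expansion —
e.g. Brown's theorem `hoffmanSpan_eq_mzvSpace` for the Hoffman base): if the value of `[Δ, ω_ε]`
is the rational combination `∑ aⱼ · value [Δ, ω_{Bⱼ}]`, the rung makes the corresponding formal
combination a relation.  (So `crux ⇒ HoffmanSpanInKZ`, cf. CoactionDevissage item 3166.) [folklore] -/
theorem sub_nf_mem_relations_of_weightKernelAdm (h : WeightKernelAdm w) {ε : Fin w → Bool}
    (hε : Adm ε) (a : Fin k → ℚ)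
    (hval : (wordRep ε 1 hε).value = ∑ j, (a j : ℝ) * (wordRep (B j) 1 (hB j)).value) :
    KZ.of (wordRep ε 1 hε) - nf B hB a ∈ KZ.relations := by
  refine h _ (sub_mem (AddSubgroup.subset_closure (of_wordRep_mem_genSetAdm _ _ _))
    (nf_mem_closure B hB a)) ?_
  rw [map_sub, KZ.eval_of, eval_nf, hval, sub_self]

/-- **RANK ONE.** If one admissible word `ε₀` of weight `w` has non-zero integral and every
admissible word representation is congruent modulo relations to a rational multiple of `[Δ, ω_{ε₀}]`,
the weight-`w` rung holds — with NO transcendence input beyond `value ≠ 0`. [folklore] -/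
theorem weightKernelAdm_of_rankOne (ε₀ : Fin w → Bool) (h₀ : Adm ε₀)
    (hv : (wordRep ε₀ 1 h₀).value ≠ 0) (ρ : (Fin w → Bool) → ℚ)
    (hρ : ∀ (ε : Fin w → Bool) (hε : Adm ε),
      KZ.of (wordRep ε 1 hε) - KZ.of (wordRep ε₀ (ρ ε) h₀) ∈ KZ.relations) :
    WeightKernelAdm w := by
  refine weightKernelAdm_of_basis (fun _ : Fin 1 => ε₀) (fun _ => h₀) ?_ fun ε hε => ⟨fun _ => ρ ε, ?_⟩
  · exact linearIndependent_unique_iff.mpr hv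
  · simpa [nf] using hρ ε hε

end Engine

end Summit.KontsevichZagierPeriods.MzvKernelInKZ.Negative
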